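import Mathlib
import Summits.Ventures.HodgeRepro.CMType
import Summits.Ventures.HodgeRepro.HodgeSets
import Summits.Ventures.HodgeRepro.CMRank
import Summits.Ventures.HodgeRepro.MuTable
import Summits.Ventures.HodgeRepro.Hecke

/-!
# μ-table entries as wedge coefficients (blind cell `pub-hodge-repro`, seat p2)

Bridge between the μ-table (`muVal Φ Δ g = |Δ ∩ gΦ|`, p2) and the group-ring bookkeeping of the
Hecke wedge (`typeOf Δ * reflexOf Φ ∈ ℤ[G]`, typer-2): the μ-table entry at `g` is the coefficient of
`[g]` in `typeOf Δ * reflexOf Φ`, i.e. the exponent of `χ_g` in the infinity type of the Hecke character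
`∏_{τ ∈ Δ} χ_τ` (Shimura 1998 Thm 19.11 / Deligne LNM 900 III (1.1')).
-/

open Finset
open scoped Pointwise

namespace HodgeRepro

variable {G : Type*} [Group G] [DecidableEq G]

/-- The μ-table entry `⟨gμ, x_Δ⟩ = |Δ ∩ gΦ|` is the coefficient of `[g]` in `typeOf Δ * reflexOf Φ`. -/
theorem muVal_eq_coeff_typeOf_mul_reflexOf (Φ Δ : Finset G) (g : G) :
    (muVal Φ Δ g : ℤ) = (Hecke.typeOf Δ * Hecke.reflexOf Φ).coeff g := by
  rw [Hecke.coeff_typeOf_mul_reflexOf]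
  rfl

/-- The μ-table entry is typer-2's pairing of `typeOf Δ` with `typeOf (gΦ)`. -/
theorem muVal_eq_pairing [Fintype G] (Φ Δ : Finset G) (g : G) :
    (muVal Φ Δ g : ℤ) = Hecke.pairing (Hecke.typeOf Δ) (Hecke.typeOf (g • Φ)) := by
  rw [Hecke.pairing_eq_coeff, muVal_eq_coeff_typeOf_mul_reflexOf]

/-- The whole μ-row of `Δ` determines the wedge element: `typeOf Δ * reflexOf Φ = Σ_g μ_Δ(g) [g]`. -/
theorem typeOf_mul_reflexOf_eq_sum_muVal [Fintype G] (Φ Δ : Finset G) :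
    Hecke.typeOf Δ * Hecke.reflexOf Φ = ∑ g : G, MonoidAlgebra.single g (muVal Φ Δ g : ℤ) := by
  apply Hecke.ext_coeff
  intro g
  rw [← muVal_eq_coeff_typeOf_mul_reflexOf]
  simp only [MonoidAlgebra.coeff_sum, Finsupp.finsetSum_apply, MonoidAlgebra.coeff_single]
  rw [Finset.sum_eq_single g]
  · simp
  · intro b _ hb
    simp [hb]
  · intro h
    exact absurd (mem_univ g) h

end HodgeRepro
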